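import Summits.Ventures.CertifiedManyBodySolver.Downfold.EmeryFermiFillingGrid384
import Summits.Ventures.CertifiedManyBodySolver.Downfold.EmeryOrbitalWeight
import HarnessLib

/-!
# THE ORBITAL PARTITION OF THE HOLES OVER THE ZONE, I: the zone-integrated Cu-d and O-p hole contents of the σ antibonding
# band, and the Riemann-sum ⇒ integral comparison on the momentum grid

Venture CertifiedManyBodySolver, cell `pub/hubbard-downfold` (stage S1; INFLATION-RULES-3to1-B §B.81), seat hubbard-downfold-mod-4
(technique B, g33); namespace `Summit.Ventures.CertifiedManyBodySolver.Downfold.Emery`. Everything PROVED (0 sorry). WHAT THIS IS NOT: a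
statement about any material; `U = 0` one-body kinematics of the σ (d–p_x–p_y + t_pp, t_pp′) model; the NMR / Zhang–Rice hole partition
is a correlated quantity this file does not address.

OBJECTS. For the σ three-band model at Fermi energy `ε` (electron picture, `ε_d = 0`, `ε_p = −Δ`; antibonding band `abBand` of
`EmeryAntibondingBand`; Cu-d Bloch weight `dWeight` of `EmeryOrbitalWeight`), on the quadrant `Q = [0, π]²` of the Brillouin zone:
* `abEnergyK k = ε_AB(k)`, `abWeightK k = w_d(k) := dWeight(x(k), y(k), ε_AB(k))` (`x = sin²(k_x/2)`), `holeInd ε k = 𝟙[ε < ε_AB(k)]`;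
* **`dHole ε = (2/π²)·∫_Q 𝟙[ε < ε_AB] · w_d`** — the Cu-d HOLE CONTENT `n_d^h` per CuO₂ (both spins) of the one-body σ model at
  Fermi energy `ε`; **`pHole ε = (2/π²)·∫_Q 𝟙[ε < ε_AB]·(1 − w_d)`** — the O-p hole content `2n_p^h` (both oxygens); `nHole` the hole
  count `(2/π²)·∫_Q 𝟙[ε < ε_AB]` (= `1 + x` at the Fermi energy of hole doping `x` when the hole set is measurable — prose; the
  certified statements below never use measurability: all three are OUTER lower Lebesgue integrals and get independent brackets).
* `dHole_anti`, `pHole_anti`, `nHole_anti`: all three are non-increasing in `ε`.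
* §3 THE GRID COMPARISON (abstract): on the `k_i = iπ/K` grid of `EmeryFermiFilling`, a finite family of half-open cells with
  per-cell constants BELOW an integrand gives `Σ c·(π/K)² ≤ ∫_Q` (`sum_cells_le_lintegral`), and a family of closed cells that covers
  the support with constants ABOVE the integrand gives `∫_Q ≤ Σ c·(π/K)²` (`lintegral_le_sum_cells`); real-valued corollaries
  `dHole_ge_of_cells`, `dHole_le_of_cells`, `pHole_ge_of_cells`, `pHole_le_of_cells`, `nHole_ge/le_of_cells`.
* §4 POINTWISE CELL LEMMAS: the sign test `charCubic(ε) < 0` at the lower-left table corner puts a whole closed cell in `{ε < ε_AB}`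
  (`lt_abBand_on_cell`), the Taylor test at the upper-right corner puts it in `{ε_AB < ε}` (`abBand_lt_on_cell`); nested grids
  (`gridPt_nested`, `cellIcc_sub_coarse`).

The kernel-checked certificate (energy shells × Möbius–Taylor weight enclosure × `K = 384 / 64` staircases) and its soundness are
in `EmeryZoneOrbitalContentCheck`; census files `EmeryZonePartition<Set>` instantiate it.
Sources: three-band model [HybertsenSchluterChristensen1989, Eq. (1)]; [AndersenEtAl1995, §6]; Lebesgue integration / interval
arithmetic [folklore] (R. E. Moore, Interval Analysis, 1966).
-/

noncomputable section

namespace Summit.Ventures.CertifiedManyBodySolver.Downfold.Emery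

open Real MeasureTheory Set
open scoped ENNReal

/-! ## §1 The zone objects -/

/-- The quadrant `Q = [0, π]²` of the Brillouin zone (one quarter; the σ model is even in `k_x`, `k_y`). [folklore] -/
def bzQuad : Set (ℝ × ℝ) := Icc (0 : ℝ) π ×ˢ Icc (0 : ℝ) π

/-- [folklore] -/
theorem measurableSet_bzQuad : MeasurableSet bzQuad := measurableSet_Icc.prod measurableSet_Icc

/-- `vol(Q) = π²` (as an extended real). [folklore] -/
theorem volume_bzQuad : volume bzQuad = ENNReal.ofReal (π - 0) * ENNReal.ofReal (π - 0) := by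
  unfold bzQuad; rw [volume_Icc_prod_Icc]

/-- [folklore] -/
theorem volume_bzQuad_ne_top : volume bzQuad ≠ ⊤ := by
  rw [volume_bzQuad]; exact ENNReal.mul_ne_top ENNReal.ofReal_ne_top ENNReal.ofReal_ne_top

/-- The antibonding-band energy at the zone point `k`: `ε_AB(k) = abBand(sin²(k_x/2), sin²(k_y/2))`.
[cite: HybertsenSchluterChristensen1989, Eq. (1) (three-band d–p model)] -/
def abEnergyK (Δ a b c : ℝ) (k : ℝ × ℝ) : ℝ := abBand Δ a b c (halfSq k.1) (halfSq k.2)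

/-- The Cu-d weight of the antibonding Bloch state at `k`: `w_d(k) = dWeight(x, y, ε_AB(k))`. [folklore] -/
def abWeightK (Δ a b c : ℝ) (k : ℝ × ℝ) : ℝ := dWeight Δ a b c (halfSq k.1) (halfSq k.2) (abEnergyK Δ a b c k)

/-- Hole indicator at Fermi energy `ε`: `1` if `ε < ε_AB(k)` (the state at `k` is EMPTY), else `0`. [folklore] -/
def holeInd (Δ a b c ε : ℝ) (k : ℝ × ℝ) : ℝ := if ε < abEnergyK Δ a b c k then 1 else 0

/-- The (extended) zone integral over the quadrant of a non-negative function. [folklore] -/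
def zoneLint (f : ℝ × ℝ → ℝ) : ℝ≥0∞ := ∫⁻ k in bzQuad, ENNReal.ofReal (f k)

/-- **THE Cu-d HOLE CONTENT `n_d^h(ε)`** of the σ antibonding band per CuO₂ (both spins): `(2/π²)·∫_Q 𝟙[ε < ε_AB(k)]·w_d(k) dk`.
[cite: HybertsenSchluterChristensen1989, Eq. (1) (three-band d–p model)] -/
def dHole (Δ a b c ε : ℝ) : ℝ := 2 / π ^ 2 * (zoneLint fun k => holeInd Δ a b c ε k * abWeightK Δ a b c k).toReal

/-- **THE O-p HOLE CONTENT `2n_p^h(ε)`** (both planar oxygens): `(2/π²)·∫_Q 𝟙[ε < ε_AB(k)]·(1 − w_d(k)) dk`.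
[cite: HybertsenSchluterChristensen1989, Eq. (1) (three-band d–p model)] -/
def pHole (Δ a b c ε : ℝ) : ℝ := 2 / π ^ 2 * (zoneLint fun k => holeInd Δ a b c ε k * (1 - abWeightK Δ a b c k)).toReal

/-- THE HOLE COUNT `n^h(ε) = (2/π²)·∫_Q 𝟙[ε < ε_AB(k)] dk` (outer integral; `= 1 + x` at the Fermi energy of hole doping `x` whenever the
hole set is measurable — not used). [folklore] -/
def nHole (Δ a b c ε : ℝ) : ℝ := 2 / π ^ 2 * (zoneLint fun k => holeInd Δ a b c ε k).toReal

/-- `holeInd ∈ {0, 1}`, hence `0 ≤ holeInd ≤ 1`. [folklore] -/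
theorem holeInd_nonneg (Δ a b c ε : ℝ) (k : ℝ × ℝ) : 0 ≤ holeInd Δ a b c ε k := by
  unfold holeInd; split_ifs <;> norm_num

/-- [folklore] -/
theorem holeInd_le_one (Δ a b c ε : ℝ) (k : ℝ × ℝ) : holeInd Δ a b c ε k ≤ 1 := by
  unfold holeInd; split_ifs <;> norm_num

/-- The hole indicator is antitone in the Fermi energy. [folklore] -/
theorem holeInd_anti (Δ a b c : ℝ) {ε₁ ε₂ : ℝ} (h : ε₁ ≤ ε₂) (k : ℝ × ℝ) : holeInd Δ a b c ε₂ k ≤ holeInd Δ a b c ε₁ k := by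
  unfold holeInd
  by_cases h2 : ε₂ < abEnergyK Δ a b c k
  · rw [if_pos h2, if_pos (lt_of_le_of_lt h h2)]
  · rw [if_neg h2]; split_ifs <;> norm_num

/-- A zone integral of a function bounded by `1` is finite. [folklore] -/
theorem zoneLint_ne_top {f : ℝ × ℝ → ℝ} (hf : ∀ k, f k ≤ 1) : zoneLint f ≠ ⊤ := by
  unfold zoneLint
  refine ne_top_of_le_ne_top ?_ (lintegral_mono (fun k => ?_) : ∫⁻ k in bzQuad, ENNReal.ofReal (f k) ≤ ∫⁻ _ in bzQuad, (1 : ℝ≥0∞))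
  · rw [setLIntegral_const, one_mul]
    exact ne_top_of_le_ne_top volume_bzQuad_ne_top le_rfl
  · calc ENNReal.ofReal (f k) ≤ ENNReal.ofReal 1 := ENNReal.ofReal_le_ofReal (hf k)
      _ = 1 := ENNReal.ofReal_one

/-- Monotonicity of `zoneLint` under a pointwise bound on the quadrant. [folklore] -/
theorem zoneLint_mono {f g : ℝ × ℝ → ℝ} (h : ∀ k ∈ bzQuad, f k ≤ g k) : zoneLint f ≤ zoneLint g := by
  unfold zoneLint
  exact setLIntegral_mono' measurableSet_bzQuad fun k hk => ENNReal.ofReal_le_ofReal (h k hk)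

/-! ## §2 Pointwise facts and antitonicity in the Fermi energy -/

section Pointwise

variable {Δ a b c : ℝ}

/-- At a hole point of a non-negative Fermi energy the band energy is positive. [folklore] -/
theorem abEnergyK_pos_of_hole {ε : ℝ} (hε : 0 ≤ ε) {k : ℝ × ℝ} (hk : ε < abEnergyK Δ a b c k) : 0 < abEnergyK Δ a b c k :=
  hε.trans_lt hk

/-- `0 ≤ w_d(k)` at a point with positive band energy (`Δ, t_pp, t_pp′ ≥ 0`). [folklore] -/
theorem abWeightK_nonneg (hΔ : 0 ≤ Δ) (hc : 0 ≤ c) (hb : 0 ≤ b) {k : ℝ × ℝ} (hk : 0 < abEnergyK Δ a b c k) :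
    0 ≤ abWeightK Δ a b c k := by
  unfold abWeightK abEnergyK at *
  exact dWeight_nonneg hΔ hc hb (halfSq_nonneg _) (halfSq_nonneg _) hk

/-- `w_d(k) ≤ 1` at a point with positive band energy. [folklore] -/
theorem abWeightK_le_one (hΔ : 0 ≤ Δ) (hc : 0 ≤ c) (hb : 0 ≤ b) {k : ℝ × ℝ} (hk : 0 < abEnergyK Δ a b c k) :
    abWeightK Δ a b c k ≤ 1 := by
  unfold abWeightK abEnergyK at *
  exact dWeight_le_one hΔ hc hb (halfSq_nonneg _) (halfSq_nonneg _) hk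

/-- The `d` integrand `𝟙·w_d` lies in `[0, 1]` (`ε ≥ 0`). [folklore] -/
theorem dIntegrand_mem (hΔ : 0 ≤ Δ) (hc : 0 ≤ c) (hb : 0 ≤ b) {ε : ℝ} (hε : 0 ≤ ε) (k : ℝ × ℝ) :
    0 ≤ holeInd Δ a b c ε k * abWeightK Δ a b c k ∧ holeInd Δ a b c ε k * abWeightK Δ a b c k ≤ 1 := by
  unfold holeInd
  by_cases h : ε < abEnergyK Δ a b c k
  · rw [if_pos h, one_mul]
    exact ⟨abWeightK_nonneg hΔ hc hb (hε.trans_lt h), abWeightK_le_one hΔ hc hb (hε.trans_lt h)⟩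
  · rw [if_neg h, zero_mul]; exact ⟨le_rfl, zero_le_one⟩

/-- The `p` integrand `𝟙·(1 − w_d)` lies in `[0, 1]` (`ε ≥ 0`). [folklore] -/
theorem pIntegrand_mem (hΔ : 0 ≤ Δ) (hc : 0 ≤ c) (hb : 0 ≤ b) {ε : ℝ} (hε : 0 ≤ ε) (k : ℝ × ℝ) :
    0 ≤ holeInd Δ a b c ε k * (1 - abWeightK Δ a b c k) ∧ holeInd Δ a b c ε k * (1 - abWeightK Δ a b c k) ≤ 1 := by
  unfold holeInd
  by_cases h : ε < abEnergyK Δ a b c k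
  · rw [if_pos h, one_mul]
    have h1 := abWeightK_nonneg hΔ hc hb (hε.trans_lt h)
    have h2 := abWeightK_le_one hΔ hc hb (hε.trans_lt h)
    constructor <;> linarith
  · rw [if_neg h, zero_mul]; exact ⟨le_rfl, zero_le_one⟩

/-- **`n_d^h` is non-increasing in the Fermi energy** (`0 ≤ ε₁ ≤ ε₂`). [folklore] -/
theorem dHole_anti (hΔ : 0 ≤ Δ) (hc : 0 ≤ c) (hb : 0 ≤ b) {ε₁ ε₂ : ℝ} (hε : 0 ≤ ε₁) (h : ε₁ ≤ ε₂) :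
    dHole Δ a b c ε₂ ≤ dHole Δ a b c ε₁ := by
  unfold dHole
  refine mul_le_mul_of_nonneg_left ?_ (by positivity)
  refine ENNReal.toReal_mono (zoneLint_ne_top fun k => (dIntegrand_mem hΔ hc hb hε k).2) (zoneLint_mono fun k _ => ?_)
  unfold holeInd
  by_cases h2 : ε₂ < abEnergyK Δ a b c k
  · rw [if_pos h2, if_pos (lt_of_le_of_lt h h2)]
  · rw [if_neg h2, zero_mul]
    exact (dIntegrand_mem hΔ hc hb hε k).1

/-- **`2n_p^h` is non-increasing in the Fermi energy** (`0 ≤ ε₁ ≤ ε₂`). [folklore] -/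
theorem pHole_anti (hΔ : 0 ≤ Δ) (hc : 0 ≤ c) (hb : 0 ≤ b) {ε₁ ε₂ : ℝ} (hε : 0 ≤ ε₁) (h : ε₁ ≤ ε₂) :
    pHole Δ a b c ε₂ ≤ pHole Δ a b c ε₁ := by
  unfold pHole
  refine mul_le_mul_of_nonneg_left ?_ (by positivity)
  refine ENNReal.toReal_mono (zoneLint_ne_top fun k => (pIntegrand_mem hΔ hc hb hε k).2) (zoneLint_mono fun k _ => ?_)
  unfold holeInd
  by_cases h2 : ε₂ < abEnergyK Δ a b c k
  · rw [if_pos h2, if_pos (lt_of_le_of_lt h h2)]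
  · rw [if_neg h2, zero_mul]
    exact (pIntegrand_mem hΔ hc hb hε k).1

/-- **The hole count is non-increasing in the Fermi energy.** [folklore] -/
theorem nHole_anti (Δ a b c : ℝ) {ε₁ ε₂ : ℝ} (h : ε₁ ≤ ε₂) : nHole Δ a b c ε₂ ≤ nHole Δ a b c ε₁ := by
  unfold nHole
  refine mul_le_mul_of_nonneg_left ?_ (by positivity)
  exact ENNReal.toReal_mono (zoneLint_ne_top fun k => holeInd_le_one _ _ _ _ _ k)
    (zoneLint_mono fun k _ => holeInd_anti Δ a b c h k)

end Pointwise

/-! ## §3 The grid comparison: Riemann sums against the zone integral -/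

/-- The closed cells are measurable. [folklore] -/
theorem measurableSet_cellIcc (K : ℕ) (ij : ℕ × ℕ) : MeasurableSet (cellIcc K ij) :=
  measurableSet_Icc.prod measurableSet_Icc

/-- A closed grid cell with indices `< K` lies in the quadrant. [folklore] -/
theorem cellIcc_subset_bzQuad {K : ℕ} (hK : 0 < K) {ij : ℕ × ℕ} (hi : ij.1 < K) (hj : ij.2 < K) : cellIcc K ij ⊆ bzQuad := by
  rintro ⟨k1, k2⟩ ⟨⟨h1, h2⟩, ⟨h3, h4⟩⟩
  exact ⟨⟨(gridPt_nonneg K _).trans h1, h2.trans (gridPt_le_pi hK hi)⟩, ⟨(gridPt_nonneg K _).trans h3, h4.trans (gridPt_le_pi hK hj)⟩⟩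

/-- The half-open cell lies in the closed cell. [folklore] -/
theorem cellIco_subset_cellIcc (K : ℕ) (ij : ℕ × ℕ) : cellIco K ij ⊆ cellIcc K ij := by
  rintro ⟨k1, k2⟩ ⟨⟨h1, h2⟩, ⟨h3, h4⟩⟩
  exact ⟨⟨h1, h2.le⟩, ⟨h3, h4.le⟩⟩

/-- **LOWER RIEMANN SUM.** If `c ij ≤ f` on every half-open cell of a finite family `S` of grid cells (indices `< K`), then
`(Σ_{S} c)·(π/K)² ≤ ∫_Q f` (extended reals; no measurability of `f` needed). [folklore] -/
theorem sum_cells_le_zoneLint {K : ℕ} (hK : 0 < K) (S : Finset (ℕ × ℕ)) (c : ℕ × ℕ → ℝ) (f : ℝ × ℝ → ℝ)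
    (hS : ∀ ij ∈ S, ij.1 < K ∧ ij.2 < K) (hc : ∀ ij ∈ S, ∀ k ∈ cellIco K ij, c ij ≤ f k) :
    (∑ ij ∈ S, ENNReal.ofReal (c ij)) * (ENNReal.ofReal (π / K) * ENNReal.ofReal (π / K)) ≤ zoneLint f := by
  rw [Finset.sum_mul]
  have h1 : ∀ ij ∈ S, ENNReal.ofReal (c ij) * (ENNReal.ofReal (π / K) * ENNReal.ofReal (π / K)) ≤
      ∫⁻ k in cellIco K ij, ENNReal.ofReal (f k) := by
    intro ij hij
    rw [← volume_cellIco hK ij, ← setLIntegral_const]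
    exact setLIntegral_mono' (measurableSet_cellIco K ij) fun k hk => ENNReal.ofReal_le_ofReal (hc ij hij k hk)
  calc ∑ ij ∈ S, ENNReal.ofReal (c ij) * (ENNReal.ofReal (π / K) * ENNReal.ofReal (π / K))
      ≤ ∑ ij ∈ S, ∫⁻ k in cellIco K ij, ENNReal.ofReal (f k) := Finset.sum_le_sum h1
    _ = ∫⁻ k in ⋃ ij ∈ S, cellIco K ij, ENNReal.ofReal (f k) :=
        (lintegral_biUnion_finset (fun ij _ ij' _ hne => cellIco_disjoint K hne) (fun ij _ => measurableSet_cellIco K ij) _).symm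
    _ ≤ zoneLint f := by
        unfold zoneLint
        refine lintegral_mono_set ?_
        intro k hk
        simp only [Set.mem_iUnion, exists_prop] at hk
        obtain ⟨ij, hij, hk⟩ := hk
        exact cellIcc_subset_bzQuad hK (hS ij hij).1 (hS ij hij).2 (cellIco_subset_cellIcc K ij hk)

/-- **UPPER RIEMANN SUM.** If every point of the quadrant where `f > 0` lies in some closed cell `ij ∈ T` with `f ≤ c ij` there
(`c ≥ 0`), then `∫_Q f ≤ (Σ_{T} c)·(π/K)²`. [folklore] -/
theorem zoneLint_le_sum_cells {K : ℕ} (hK : 0 < K) (T : Finset (ℕ × ℕ)) (c : ℕ × ℕ → ℝ) (f : ℝ × ℝ → ℝ)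
    (hcov : ∀ k ∈ bzQuad, 0 < f k → ∃ ij ∈ T, k ∈ cellIcc K ij ∧ f k ≤ c ij) :
    zoneLint f ≤ (∑ ij ∈ T, ENNReal.ofReal (c ij)) * (ENNReal.ofReal (π / K) * ENNReal.ofReal (π / K)) := by
  set G : ℝ × ℝ → ℝ≥0∞ := fun k => ∑ ij ∈ T, (cellIcc K ij).indicator (fun _ => ENNReal.ofReal (c ij)) k with hG
  have hpt : ∀ k ∈ bzQuad, ENNReal.ofReal (f k) ≤ G k := by
    intro k hk
    rcases le_or_gt (f k) 0 with h0 | hpos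
    · rw [ENNReal.ofReal_of_nonpos h0]; exact bot_le
    · obtain ⟨ij, hij, hkc, hfc⟩ := hcov k hk hpos
      calc ENNReal.ofReal (f k) ≤ ENNReal.ofReal (c ij) := ENNReal.ofReal_le_ofReal hfc
        _ = (cellIcc K ij).indicator (fun _ => ENNReal.ofReal (c ij)) k := by rw [Set.indicator_of_mem hkc]
        _ ≤ G k := by
            rw [hG]
            exact Finset.single_le_sum (f := fun ij => (cellIcc K ij).indicator (fun _ => ENNReal.ofReal (c ij)) k)
              (fun _ _ => bot_le) hij
  calc zoneLint f ≤ ∫⁻ k in bzQuad, G k := setLIntegral_mono' measurableSet_bzQuad hpt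
    _ ≤ ∫⁻ k, G k := setLIntegral_le_lintegral _ _
    _ = ∑ ij ∈ T, ∫⁻ k, (cellIcc K ij).indicator (fun _ => ENNReal.ofReal (c ij)) k := by
        rw [hG]
        exact lintegral_finsetSum _ fun ij _ => measurable_const.indicator (measurableSet_cellIcc K ij)
    _ = ∑ ij ∈ T, ENNReal.ofReal (c ij) * (ENNReal.ofReal (π / K) * ENNReal.ofReal (π / K)) := by
        refine Finset.sum_congr rfl fun ij _ => ?_
        rw [lintegral_indicator_const (measurableSet_cellIcc K ij), volume_cellIcc hK]
    _ = (∑ ij ∈ T, ENNReal.ofReal (c ij)) * (ENNReal.ofReal (π / K) * ENNReal.ofReal (π / K)) := by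
        rw [Finset.sum_mul]

/-- From extended to real: a LOWER sum bound `(Σ c)·(π/K)² ≤ ∫_Q f` with `c ≥ 0` and `∫_Q f < ∞` gives
`(2/K²)·Σ c ≤ (2/π²)·(∫_Q f).toReal`. [folklore] -/
theorem real_lower_of_sum_le {K : ℕ} (hK : 0 < K) {S : Finset (ℕ × ℕ)} {c : ℕ × ℕ → ℝ} {f : ℝ × ℝ → ℝ}
    (hc0 : ∀ ij ∈ S, 0 ≤ c ij) (hfin : zoneLint f ≠ ⊤)
    (h : (∑ ij ∈ S, ENNReal.ofReal (c ij)) * (ENNReal.ofReal (π / K) * ENNReal.ofReal (π / K)) ≤ zoneLint f) :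
    2 / (K : ℝ) ^ 2 * ∑ ij ∈ S, c ij ≤ 2 / π ^ 2 * (zoneLint f).toReal := by
  have hKr : (0 : ℝ) < K := by exact_mod_cast hK
  have hπ := Real.pi_pos
  have hsum : ∑ ij ∈ S, ENNReal.ofReal (c ij) = ENNReal.ofReal (∑ ij ∈ S, c ij) := (ENNReal.ofReal_sum_of_nonneg hc0).symm
  rw [hsum, ← ENNReal.ofReal_mul (by positivity), ← ENNReal.ofReal_mul (Finset.sum_nonneg hc0)] at h
  have h2 := (ENNReal.ofReal_le_iff_le_toReal hfin).1 h
  have hKK : (2 / π ^ 2) * ((∑ ij ∈ S, c ij) * (π / K * (π / K))) = 2 / (K : ℝ) ^ 2 * ∑ ij ∈ S, c ij := by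
    field_simp
  rw [← hKK]
  exact mul_le_mul_of_nonneg_left h2 (by positivity)

/-- From extended to real: an UPPER sum bound with `c ≥ 0` gives `(2/π²)·(∫_Q f).toReal ≤ (2/K²)·Σ c`. [folklore] -/
theorem real_upper_of_le_sum {K : ℕ} (hK : 0 < K) {T : Finset (ℕ × ℕ)} {c : ℕ × ℕ → ℝ} {f : ℝ × ℝ → ℝ}
    (hc0 : ∀ ij ∈ T, 0 ≤ c ij)
    (h : zoneLint f ≤ (∑ ij ∈ T, ENNReal.ofReal (c ij)) * (ENNReal.ofReal (π / K) * ENNReal.ofReal (π / K))) :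
    2 / π ^ 2 * (zoneLint f).toReal ≤ 2 / (K : ℝ) ^ 2 * ∑ ij ∈ T, c ij := by
  have hKr : (0 : ℝ) < K := by exact_mod_cast hK
  have hπ := Real.pi_pos
  have hsum : ∑ ij ∈ T, ENNReal.ofReal (c ij) = ENNReal.ofReal (∑ ij ∈ T, c ij) := (ENNReal.ofReal_sum_of_nonneg hc0).symm
  rw [hsum, ← ENNReal.ofReal_mul (by positivity), ← ENNReal.ofReal_mul (Finset.sum_nonneg hc0)] at h
  have h2 := ENNReal.toReal_le_of_le_ofReal (mul_nonneg (Finset.sum_nonneg hc0) (by positivity)) h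
  have hKK : (2 / π ^ 2) * ((∑ ij ∈ T, c ij) * (π / K * (π / K))) = 2 / (K : ℝ) ^ 2 * ∑ ij ∈ T, c ij := by
    field_simp
  rw [← hKK]
  exact mul_le_mul_of_nonneg_left h2 (by positivity)

/-! ## §4 Pointwise cell lemmas -/

section Cells

variable {Δ a b c : ℝ}

/-- Table enclosure of a point of a closed cell: `xl i ≤ x(k₁) ≤ xh (i + 1)` (and the same for `y`). [folklore] -/
theorem halfSq_mem_of_cell {K : ℕ} (hK : 0 < K) {xl xh : ℕ → ℚ} (hG : GridEncl K xl xh) {i : ℕ} (hi : i + 1 ≤ K) {t : ℝ}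
    (h1 : gridPt K i ≤ t) (h2 : t ≤ gridPt K (i + 1)) : (xl i : ℝ) ≤ halfSq t ∧ halfSq t ≤ (xh (i + 1) : ℝ) := by
  have htπ : t ≤ π := h2.trans (gridPt_le_pi hK hi)
  have ht0 : 0 ≤ t := (gridPt_nonneg K i).trans h1
  exact ⟨(hG i (by omega)).2.1.trans (halfSq_mono (gridPt_nonneg K i) h1 htπ),
    (halfSq_mono ht0 h2 (gridPt_le_pi hK hi)).trans (hG _ hi).2.2⟩

/-- **OUTER SIGN TEST ⇒ HOLE CELL.** If `cA(ε) − 4fsD(ε)(xl i + xl j) − 16fsN(ε)·xl i·xl j < 0` with `fsD(ε), fsN(ε) ≥ 0`, then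
`ε < ε_AB(k)` at every point of the closed cell `(i, j)`. [folklore] -/
theorem lt_abBand_on_cell {K : ℕ} (hK : 0 < K) {xl xh : ℕ → ℚ} (hG : GridEncl K xl xh) {i j : ℕ} (hi : i + 1 ≤ K)
    (hj : j + 1 ≤ K) {ε : ℝ} (hD : 0 ≤ fsD Δ a c ε) (hN : 0 ≤ fsN a b c ε)
    (htest : cA Δ ε - 4 * fsD Δ a c ε * ((xl i : ℝ) + xl j) - 16 * fsN a b c ε * ((xl i : ℝ) * xl j) < 0)
    {k : ℝ × ℝ} (hk : k ∈ cellIcc K (i, j)) : ε < abEnergyK Δ a b c k := by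
  obtain ⟨⟨h1, h2⟩, ⟨h3, h4⟩⟩ := hk
  obtain ⟨hxl, -⟩ := halfSq_mem_of_cell hK hG hi h1 h2
  obtain ⟨hyl, -⟩ := halfSq_mem_of_cell hK hG hj h3 h4
  set x := halfSq k.1
  set y := halfSq k.2
  have hxl0 : 0 ≤ (xl i : ℝ) := (hG i (by omega)).1
  have hyl0 : 0 ≤ (xl j : ℝ) := (hG j (by omega)).1
  have hcc : charCubic Δ a b c x y ε < 0 := by
    rw [charCubic_bilinear]
    have := bilin_antitone (A := cA Δ ε) hD hN hxl0 hyl0 hxl hyl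
    linarith
  have hle : ε ≤ abBand Δ a b c x y := le_abBand_of_charCubic_nonpos hcc.le
  rcases hle.lt_or_eq with hlt | heq
  · exact hlt
  · exfalso
    have h0 := charCubic_abBand Δ a b c x y
    rw [← heq] at h0
    linarith

/-- **INNER TAYLOR TEST ⇒ OCCUPIED CELL.** If `cA(ε) − 4fsD(ε)(xh(i+1) + xh(j+1)) − 16fsN(ε)·xh(i+1)·xh(j+1) > 0` and the Taylor side
condition `3ε² + 4Δε + Δ² − 16t_pp²·xh(i+1)xh(j+1) − 4t_pd²(xh(i+1) + xh(j+1)) ≥ 0` hold (`Δ, t_pp′, ε ≥ 0`, `fsD, fsN ≥ 0`), then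
`ε_AB(k) < ε` at every point of the closed cell `(i, j)`. [folklore] -/
theorem abBand_lt_on_cell {K : ℕ} (hK : 0 < K) {xl xh : ℕ → ℚ} (hG : GridEncl K xl xh) {i j : ℕ} (hi : i + 1 ≤ K)
    (hj : j + 1 ≤ K) {ε : ℝ} (hΔ : 0 ≤ Δ) (hc : 0 ≤ c) (hε : 0 ≤ ε) (hD : 0 ≤ fsD Δ a c ε) (hN : 0 ≤ fsN a b c ε)
    (htest : 0 < cA Δ ε - 4 * fsD Δ a c ε * ((xh (i + 1) : ℝ) + xh (j + 1)) - 16 * fsN a b c ε * ((xh (i + 1) : ℝ) * xh (j + 1)))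
    (htay : 0 ≤ 3 * ε ^ 2 + 4 * Δ * ε + Δ ^ 2 - 16 * b ^ 2 * ((xh (i + 1) : ℝ) * xh (j + 1))
      - 4 * a ^ 2 * ((xh (i + 1) : ℝ) + xh (j + 1)))
    {k : ℝ × ℝ} (hk : k ∈ cellIcc K (i, j)) : abEnergyK Δ a b c k < ε := by
  obtain ⟨⟨h1, h2⟩, ⟨h3, h4⟩⟩ := hk
  obtain ⟨hxl, hxX⟩ := halfSq_mem_of_cell hK hG hi h1 h2
  obtain ⟨hyl, hyY⟩ := halfSq_mem_of_cell hK hG hj h3 h4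
  set x := halfSq k.1
  set y := halfSq k.2
  have hx0 : 0 ≤ x := halfSq_nonneg _
  have hy0 : 0 ≤ y := halfSq_nonneg _
  have hX0 : 0 ≤ (xh (i + 1) : ℝ) := hx0.trans hxX
  have hY0 : 0 ≤ (xh (j + 1) : ℝ) := hy0.trans hyY
  have hxy : x * y ≤ (xh (i + 1) : ℝ) * xh (j + 1) := mul_le_mul hxX hyY hy0 hX0
  have hcc : 0 < charCubic Δ a b c x y ε := by
    rw [charCubic_bilinear]
    have := bilin_antitone (A := cA Δ ε) hD hN hx0 hy0 hxX hyY
    linarith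
  have p1 : 0 ≤ 4 * c * x := by positivity
  have p2 : 0 ≤ 4 * c * y := by positivity
  have hcubA : 2 * Δ ≤ cubA Δ c x y := by unfold cubA; linarith
  have hcubB : Δ ^ 2 - 16 * b ^ 2 * ((xh (i + 1) : ℝ) * xh (j + 1)) - 4 * a ^ 2 * ((xh (i + 1) : ℝ) + xh (j + 1))
      ≤ cubB Δ a b c x y := by
    have e0 : cubB Δ a b c x y = (Δ + 4 * c * x) * (Δ + 4 * c * y) - 16 * (b ^ 2 * (x * y)) - 4 * (a ^ 2 * (x + y)) := by
      unfold cubB; ring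
    have e2 : Δ ^ 2 ≤ (Δ + 4 * c * x) * (Δ + 4 * c * y) := by nlinarith [mul_nonneg hΔ p2, mul_nonneg p1 hΔ, mul_nonneg p1 p2]
    have e3 : b ^ 2 * (x * y) ≤ b ^ 2 * ((xh (i + 1) : ℝ) * xh (j + 1)) := mul_le_mul_of_nonneg_left hxy (sq_nonneg _)
    have e4 : a ^ 2 * (x + y) ≤ a ^ 2 * ((xh (i + 1) : ℝ) + xh (j + 1)) := mul_le_mul_of_nonneg_left (add_le_add hxX hyY) (sq_nonneg _)
    rw [e0]; linarith
  have hq1 : 0 ≤ 3 * ε ^ 2 + 2 * cubA Δ c x y * ε + cubB Δ a b c x y := by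
    have := mul_le_mul_of_nonneg_right hcubA hε
    nlinarith
  have hq2 : 0 ≤ 3 * ε + cubA Δ c x y := by linarith
  exact abBand_lt_of_taylor hcc hq1 hq2

/-- Nested grids: `gridPt (R·K) (R·i) = gridPt K i`. [folklore] -/
theorem gridPt_nested {K R : ℕ} (hR : 0 < R) (i : ℕ) : gridPt (R * K) (R * i) = gridPt K i := by
  unfold gridPt
  have hRr : (R : ℝ) ≠ 0 := by exact_mod_cast hR.ne'
  rcases Nat.eq_zero_or_pos K with hK | hK
  · subst hK; simp
  · have hKr : (K : ℝ) ≠ 0 := by exact_mod_cast hK.ne'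
    push_cast
    field_simp

/-- Nested grids: a closed fine cell `(i, j)` of the `R·K` grid lies in the closed coarse cell `(i/R, j/R)` of the `K` grid. [folklore] -/
theorem cellIcc_sub_coarse {K R : ℕ} (hR : 0 < R) (ij : ℕ × ℕ) :
    cellIcc (R * K) ij ⊆ cellIcc K (ij.1 / R, ij.2 / R) := by
  rintro ⟨k1, k2⟩ ⟨⟨h1, h2⟩, ⟨h3, h4⟩⟩
  have lo : ∀ i : ℕ, gridPt K (i / R) ≤ gridPt (R * K) i := fun i => by
    rw [← gridPt_nested hR (i / R)]; exact gridPt_mono _ (Nat.mul_div_le i R)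
  have hi : ∀ i : ℕ, gridPt (R * K) (i + 1) ≤ gridPt K (i / R + 1) := fun i => by
    rw [← gridPt_nested hR (i / R + 1)]
    refine gridPt_mono _ ?_
    rw [Nat.mul_add, Nat.mul_one]
    have := Nat.lt_mul_div_succ i hR
    rw [Nat.mul_succ] at this
    omega
  exact ⟨⟨(lo _).trans h1, h2.trans (hi _)⟩, ⟨(lo _).trans h3, h4.trans (hi _)⟩⟩

end Cells

end Summit.Ventures.CertifiedManyBodySolver.Downfold.Emery
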